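import Mathlib
import Literature.Analysis.FluidPDE.ClassicalSolution
import Literature.Analysis.FluidPDE.LerayHopf
import Literature.Analysis.FluidPDE.SuitableWeak
import Literature.Analysis.FluidPDE.LocalTypeI
import Literature.Analysis.FluidPDE.CKN1982Setting
import Literature.Analysis.FluidPDE.ClassicalSuitable
import Literature.Analysis.FluidPDE.NSViscosityRescaling
import Literature.Analysis.FluidPDE.NSLerayHopfABCScaling
import Literature.Analysis.FluidPDE.PressureDecayEstimate
import Literature.Analysis.FluidPDE.PressureDecayEstimateProofs
import Literature.Analysis.FluidPDE.ClassicalTopPointCubic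
import Literature.Analysis.FluidPDE.BesovBlowupConcentration
import Literature.Analysis.FluidPDE.LerayHopfSpatialGradient
import Literature.Analysis.FluidPDE.NSSuitableESSProofs
import Literature.Analysis.FluidPDE.Seregin2020ScaledEnergyBounds

/-!
# N25 «THE STATIC SKIRT» · ONSAGER EDGE — K5 «THE CONE SETS THE CLOCK»: RT ⟹ CC (PROVED rung)
Lens-6 g15 kernel K5 (critic row 163 booking (3)): near a tame-conical jolting skirt vertex the VELOCITY CLOCK
`‖u(t,x)‖ ≤ K (T − t)^{−a/(1+a)}` on a fixed ball (aside RT `VelocityClockedSkirt` of the child route `RootDecompOnsagerEdge`)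
plus the tempered envelope gives the CUBIC GAUGE CC `ConicalSkirtCubicGauge` (Tonelli + Hölder in time, two regimes split at
`σ* = r^{1+a}`); RT / CC are VERBATIM ledger signatures, the tempered hypothesis of the inner lemmas is spelled inline.
Sources: Seregin 2026 (1.7)/(3.1); CKN 1982 §2; lens file HOME/decomp-ns-lens-6/OnsagerEdge.lean §11 (K5).
-/

noncomputable section
set_option linter.dupNamespace false
namespace Summit.NavierStokesRegularity.NavierStokesRegularity.Theorems.RootDecompStaticSkirtVelocityClock

open scoped Topology ENNReal NNReal InnerProductSpace RealInnerProductSpace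
open Filter Set MeasureTheory Metric Function
open Literature.Analysis.FluidPDE
/-! ## K5 · velocity clock + tempered ⟹ cubic gauge -/

/-- `‖a‖² ≤ 2‖a − b‖² + 2‖b‖²` in `ℝ≥0∞` form. [folklore; copy of a private tree helper] -/
private theorem enorm_sq_le_two {E : Type*} [NormedAddCommGroup E] (a b : E) :
    ‖a‖ₑ ^ 2 ≤ 2 * ‖a - b‖ₑ ^ 2 + 2 * ‖b‖ₑ ^ 2 := by
  have h : ‖a‖ ^ 2 ≤ 2 * ‖a - b‖ ^ 2 + 2 * ‖b‖ ^ 2 := by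
    nlinarith [norm_le_insert' a b, sq_nonneg (‖a - b‖ - ‖b‖), norm_nonneg (a - b), norm_nonneg b, norm_nonneg a]
  have e1 : ‖a‖ₑ ^ 2 = ENNReal.ofReal (‖a‖ ^ 2) := by rw [← ofReal_norm, ENNReal.ofReal_pow (norm_nonneg _)]
  have e2 : ‖a - b‖ₑ ^ 2 = ENNReal.ofReal (‖a - b‖ ^ 2) := by rw [← ofReal_norm, ENNReal.ofReal_pow (norm_nonneg _)]
  have e3 : ‖b‖ₑ ^ 2 = ENNReal.ofReal (‖b‖ ^ 2) := by rw [← ofReal_norm, ENNReal.ofReal_pow (norm_nonneg _)]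
  rw [e1, e2, e3, ← ENNReal.ofReal_ofNat 2, ← ENNReal.ofReal_mul (by norm_num), ← ENNReal.ofReal_mul (by norm_num),
    ← ENNReal.ofReal_add (by positivity) (by positivity)]
  exact ENNReal.ofReal_le_ofReal h

/-- early-regime time integral: `∫_A^m (d − s)^{−γ} ds ≤ (d − m)^{1−γ}/(γ − 1)` for `γ > 1`, `A ≤ m < d`. -/
theorem early_time_integral {A m d γ : ℝ} (hγ : 1 < γ) (hAm : A ≤ m) (hmd : m < d) :
    ∫ s in A..m, (d - s) ^ (-γ) ≤ (d - m) ^ (1 - γ) / (γ - 1) := by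
  have hσ : 0 < d - m := by linarith
  have hσ' : 0 < d - A := by linarith
  rw [intervalIntegral.integral_comp_sub_left (fun x => x ^ (-γ)) d]
  have h0 : (0 : ℝ) ∉ Set.uIcc (d - m) (d - A) := by
    rw [Set.uIcc_of_le (by linarith)]; intro h; exact absurd h.1 (by linarith)
  rw [integral_rpow (Or.inr ⟨by linarith, h0⟩), show -γ + 1 = 1 - γ by ring]
  have hpos : 0 ≤ (d - A) ^ (1 - γ) := Real.rpow_nonneg hσ'.le _
  have hγ' : 0 < γ - 1 := by linarith
  rw [show ((d - A) ^ (1 - γ) - (d - m) ^ (1 - γ)) / (1 - γ) =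
      ((d - m) ^ (1 - γ) - (d - A) ^ (1 - γ)) / (γ - 1) by
    rw [show (1 - γ) = -(γ - 1) by ring, div_neg, neg_div', neg_sub]]
  exact div_le_div_of_nonneg_right (by linarith) hγ'.le

/-- late-regime time integral: `∫_{d−σ}^d (d − s)^{−β} ds = σ^{1−β}/(1 − β)` for `β < 1`, `σ ≥ 0`. -/
theorem late_time_integral {σ d β : ℝ} (hβ : β < 1) (_hσ : 0 ≤ σ) :
    ∫ s in (d - σ)..d, (d - s) ^ (-β) = σ ^ (1 - β) / (1 - β) := by
  rw [intervalIntegral.integral_comp_sub_left (fun x => x ^ (-β)) d, sub_self, sub_sub_cancel,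
    integral_rpow (Or.inl (by linarith)), show -β + 1 = 1 - β by ring,
    Real.zero_rpow (by linarith : (1 - β) ≠ 0), sub_zero]

/-- physical-slice `L²` bound at a tempered vertex, on the last parabolic window of the normalised clock (g14 K1's inner
step, isolated). -/
theorem sliceSq_le_of_temperedAt {ν T : ℝ} (hν : 0 < ν)
    {u : ℝ → EuclideanSpace ℝ (Fin 3) → EuclideanSpace ℝ (Fin 3)} (hTm : AEStronglyMeasurable (u T) volume)
    {x₀ : EuclideanSpace ℝ (Fin 3)} {a r₀ C J : ℝ} (hC : 0 ≤ C) (hJ : 0 ≤ J)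
    (htemp : (∀ ρ ∈ Set.Ioc 0 r₀, (∫⁻ x in ball x₀ ρ, ‖u T x‖ₑ ^ 2 ≤ ENNReal.ofReal (C * ρ ^ (3 - 2 * a))) ∧
      ∀ s ∈ Set.Ioo (T - ρ ^ 2 / ν) T, ∫⁻ x in ball x₀ ρ, ‖u s x - u T x‖ₑ ^ 2 ≤ ENNReal.ofReal J * ∫⁻ x in ball x₀ ρ, ‖u T x‖ₑ ^ 2)) {r : ℝ} (hr : r ∈ Set.Ioc 0 r₀) {t : ℝ}
    (ht : t ∈ Set.Ioo (ν * T - r ^ 2) (ν * T)) :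
    ∫⁻ x in ball x₀ r, ‖u (t / ν) x‖ₑ ^ 2 ≤ ENNReal.ofReal ((2 * J + 2) * (C * r ^ (3 - 2 * a))) := by
  obtain ⟨henv, hjolt⟩ := htemp r hr
  have hr0 : 0 < r := hr.1
  have hs : t / ν ∈ Set.Ioo (T - r ^ 2 / ν) T := by
    constructor
    · rw [lt_div_iff₀ hν, sub_mul, div_mul_cancel₀ _ hν.ne']; linarith [ht.1]
    · rw [div_lt_iff₀ hν]; linarith [ht.2]
  have hg : AEMeasurable (fun x => 2 * ‖u T x‖ₑ ^ 2) (volume.restrict (ball x₀ r)) :=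
    ((hTm.enorm.pow_const 2).const_mul 2).restrict
  calc ∫⁻ x in ball x₀ r, ‖u (t / ν) x‖ₑ ^ 2
      ≤ ∫⁻ x in ball x₀ r, (2 * ‖u (t / ν) x - u T x‖ₑ ^ 2 + 2 * ‖u T x‖ₑ ^ 2) :=
        lintegral_mono fun x => enorm_sq_le_two _ _
    _ = (2 * ∫⁻ x in ball x₀ r, ‖u (t / ν) x - u T x‖ₑ ^ 2) + 2 * ∫⁻ x in ball x₀ r, ‖u T x‖ₑ ^ 2 := by
        rw [lintegral_add_right' _ hg, lintegral_const_mul' 2 _ ENNReal.ofNat_ne_top,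
          lintegral_const_mul' 2 _ ENNReal.ofNat_ne_top]
    _ ≤ 2 * (ENNReal.ofReal J * ENNReal.ofReal (C * r ^ (3 - 2 * a))) + 2 * ENNReal.ofReal (C * r ^ (3 - 2 * a)) := by
        exact add_le_add (mul_le_mul_right ((hjolt (t / ν) hs).trans (mul_le_mul_right henv _)) _)
          (mul_le_mul_right henv _)
    _ = ENNReal.ofReal ((2 * J + 2) * (C * r ^ (3 - 2 * a))) := by
        rw [show (2 * J + 2) * (C * r ^ (3 - 2 * a)) = 2 * (J * (C * r ^ (3 - 2 * a))) + 2 * (C * r ^ (3 - 2 * a)) by ring,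
          ENNReal.ofReal_add (by positivity) (by positivity), ENNReal.ofReal_mul (by norm_num : (0:ℝ) ≤ 2),
          ENNReal.ofReal_mul (by norm_num : (0:ℝ) ≤ 2), ENNReal.ofReal_mul hJ, ENNReal.ofReal_ofNat]

/-- **K5 · «THE CONE SETS THE CLOCK»: velocity clock + tempered ⟹ cubic gauge.** If near the vertex the speed obeys
the cone's advective clock `‖u(t,x)‖ ≤ K (T − t)^{−a/(1+a)}` (`x ∈ B_{r₂}(x₀)`, `t ∈ (T − r₂², T)`) and the vertex is
tempered (exponent `a > 1`, constants `C, J`), then the normalised solution `v = ν⁻¹u(·/ν)` obeys the cubic gauge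
`r^{2(a−1)} C(r; νT, x₀) ≤ M` for small `r`. Proof: Tonelli; on the last window split at `σ* = r^{1+a}` — early slices by
the cube of the clock (`∫_{σ*}^{r²} σ^{−3β} ≤ σ*^{1−3β}/(3β−1)`, `3β > 1`), late slices by clock × tempered slice energy
(`∫_0^{σ*} σ^{−β} = σ*^{1−β}/(1−β)`, `β < 1`); both produce exactly `r^{4−2a}` (`(1+a)β = a`). -/
theorem cubicGauge_of_velocityClock {ν T : ℝ} (hν : 0 < ν) (hT : 0 < T)
    {u : ℝ → EuclideanSpace ℝ (Fin 3) → EuclideanSpace ℝ (Fin 3)} {p : ℝ → EuclideanSpace ℝ (Fin 3) → ℝ}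
    (hmax : IsMaximalSmoothSolution ν 0 u p T) (hLH : IsLerayHopfOn T ν 0 (u 0) u)
    {x₀ : EuclideanSpace ℝ (Fin 3)} {a r₀ C J K r₂ : ℝ} (ha1 : 1 < a) (hr₀ : 0 < r₀) (hC : 0 ≤ C) (hJ : 0 ≤ J)
    (hK : 0 ≤ K) (hr₂ : 0 < r₂) (htemp : (∀ ρ ∈ Set.Ioc 0 r₀, (∫⁻ x in ball x₀ ρ, ‖u T x‖ₑ ^ 2 ≤ ENNReal.ofReal (C * ρ ^ (3 - 2 * a))) ∧
      ∀ s ∈ Set.Ioo (T - ρ ^ 2 / ν) T, ∫⁻ x in ball x₀ ρ, ‖u s x - u T x‖ₑ ^ 2 ≤ ENNReal.ofReal J * ∫⁻ x in ball x₀ ρ, ‖u T x‖ₑ ^ 2))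
    (hclock : ∀ t ∈ Set.Ioo (T - r₂ ^ 2) T, ∀ x ∈ ball x₀ r₂, ‖u t x‖ ≤ K * (T - t) ^ (-(a / (1 + a)))) :
    ∃ (r₁ : ℝ) (M : NNReal), 0 < r₁ ∧ ∀ r' ∈ Set.Ioc 0 r₁,
      ENNReal.ofReal (r' ^ (2 * (a - 1))) * cknC r' (ν * T, x₀) (fun s y => ν⁻¹ • u (s / ν) y) ≤ M := by
  set vNu : ℝ → EuclideanSpace ℝ (Fin 3) → EuclideanSpace ℝ (Fin 3) := fun s y => ν⁻¹ • u (s / ν) y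
    with hvNu_def
  set β : ℝ := a / (1 + a) with hβdef
  have h1a : 0 < 1 + a := by linarith
  have hβpos : 0 < β := div_pos (by linarith) h1a
  have hβ1 : β < 1 := by rw [hβdef, div_lt_one h1a]; linarith
  have h3β : 1 < 3 * β := by rw [hβdef, mul_div_assoc', lt_div_iff₀ h1a]; linarith
  have hβa : (1 + a) * β = a := by rw [hβdef]; field_simp
  have hν0 : ν ≠ 0 := hν.ne'
  have hTm : AEStronglyMeasurable (u T) volume := (hLH.memLp T ⟨hT.le, le_rfl⟩).aestronglyMeasurable
  have hcont : ContinuousOn (uncurry u) (Set.Ico 0 T ×ˢ univ) := by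
    have h := hmax.1.smooth_velocity
    unfold IsSmoothSpaceTimeOn at h
    exact h.continuousOn
  -- the radius
  have hνm : 0 < ν * min (r₂ ^ 2) T := mul_pos hν (lt_min (pow_pos hr₂ 2) hT)
  set r₁ : ℝ := min (min r₀ (min r₂ 1)) (Real.sqrt (ν * min (r₂ ^ 2) T)) with hr₁def
  have hr₁ : 0 < r₁ := lt_min (lt_min hr₀ (lt_min hr₂ one_pos)) (Real.sqrt_pos.2 hνm)
  have hr₁r₀ : r₁ ≤ r₀ := (min_le_left _ _).trans (min_le_left _ _)
  have hr₁r₂ : r₁ ≤ r₂ := (min_le_left _ _).trans ((min_le_right _ _).trans (min_le_left _ _))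
  have hr₁1 : r₁ ≤ 1 := (min_le_left _ _).trans ((min_le_right _ _).trans (min_le_right _ _))
  have hr₁sq : r₁ ^ 2 ≤ ν * min (r₂ ^ 2) T := by
    have h1 : r₁ ≤ Real.sqrt (ν * min (r₂ ^ 2) T) := min_le_right _ _
    calc r₁ ^ 2 ≤ Real.sqrt (ν * min (r₂ ^ 2) T) ^ 2 := pow_le_pow_left₀ hr₁.le h1 2
      _ = ν * min (r₂ ^ 2) T := Real.sq_sqrt hνm.le
  have hr₁ν2 : r₁ ^ 2 ≤ ν * r₂ ^ 2 := hr₁sq.trans (mul_le_mul_of_nonneg_left (min_le_left _ _) hν.le)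
  have hr₁νT : r₁ ^ 2 ≤ ν * T := hr₁sq.trans (mul_le_mul_of_nonneg_left (min_le_right _ _) hν.le)
  -- constants
  set κ : ℝ := K * ν ^ (β - 1) with hκdef
  have hκ : 0 ≤ κ := mul_nonneg hK (Real.rpow_nonneg hν.le _)
  set V : ℝ≥0∞ := volume (ball (0 : EuclideanSpace ℝ (Fin 3)) 1) with hVdef
  have hVtop : V ≠ ⊤ := measure_ball_lt_top.ne
  set Mtot : ℝ≥0∞ := V * ENNReal.ofReal (κ ^ 3 / (3 * β - 1)) +
    ENNReal.ofReal (ν⁻¹ ^ 2 * ((2 * J + 2) * C) * (κ / (1 - β))) with hMdef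
  have hMtop : Mtot ≠ ⊤ :=
    ENNReal.add_ne_top.2 ⟨ENNReal.mul_ne_top hVtop ENNReal.ofReal_ne_top, ENNReal.ofReal_ne_top⟩
  refine ⟨r₁, Mtot.toNNReal, hr₁, fun r' hr' => ?_⟩
  rw [ENNReal.coe_toNNReal hMtop]
  have hR0 : 0 < r' := hr'.1
  have hR1 : r' ≤ 1 := hr'.2.trans hr₁1
  have hRr₀ : r' ≤ r₀ := hr'.2.trans hr₁r₀
  have hRr₂ : r' ≤ r₂ := hr'.2.trans hr₁r₂
  have hRsq : r' ^ 2 ≤ r₁ ^ 2 := pow_le_pow_left₀ hR0.le hr'.2 2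
  have hRν2 : r' ^ 2 ≤ ν * r₂ ^ 2 := hRsq.trans hr₁ν2
  have hRνT : r' ^ 2 ≤ ν * T := hRsq.trans hr₁νT
  -- the split time σ* = r'^{1+a} ≤ r'^2
  set σs : ℝ := r' ^ (1 + a) with hσsdef
  have hσs : 0 < σs := Real.rpow_pos_of_pos hR0 _
  have hσs2 : σs ≤ r' ^ 2 := by
    rw [hσsdef, ← Real.rpow_natCast r' 2]
    exact Real.rpow_le_rpow_of_exponent_ge hR0 hR1 (by push_cast; linarith)
  -- the window
  set d : ℝ := ν * T with hddef
  set A : ℝ := d - r' ^ 2 with hAdef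
  set m : ℝ := d - σs with hmdef
  have hAm : A ≤ m := by rw [hAdef, hmdef]; linarith
  have hmd : m < d := by rw [hmdef]; linarith
  have hA0 : 0 ≤ A := by rw [hAdef, hddef]; linarith
  have hdm : d - m = σs := by rw [hmdef]; ring
  -- pointwise clock bound in the normalised variables
  have hpt : ∀ s ∈ Set.Ioo A d, ∀ y ∈ ball x₀ r', ‖ν⁻¹ • u (s / ν) y‖ ≤ κ * (d - s) ^ (-β) := by
    intro s hs y hy
    have hds : 0 < d - s := by linarith [hs.2]
    have hsA : A < s := hs.1
    have hsd : s < d := hs.2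
    rw [hAdef, hddef] at hsA
    rw [hddef] at hsd
    have ht : s / ν ∈ Set.Ioo (T - r₂ ^ 2) T := by
      constructor
      · rw [lt_div_iff₀ hν]; nlinarith [hsA, hRν2]
      · rw [div_lt_iff₀ hν]; linarith [hsd]
    have hy' : y ∈ ball x₀ r₂ := ball_subset_ball hRr₂ hy
    have h1 := hclock (s / ν) ht y hy'
    have hTs : T - s / ν = (d - s) / ν := by rw [hddef]; field_simp
    rw [hTs, Real.div_rpow hds.le hν.le, Real.rpow_neg hν.le β, div_inv_eq_mul] at h1
    rw [norm_smul, Real.norm_eq_abs, abs_of_pos (inv_pos.2 hν)]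
    calc ν⁻¹ * ‖u (s / ν) y‖ ≤ ν⁻¹ * (K * ((d - s) ^ (-β) * ν ^ β)) :=
          mul_le_mul_of_nonneg_left h1 (inv_pos.2 hν).le
      _ = κ * (d - s) ^ (-β) := by rw [hκdef, Real.rpow_sub_one hν0 β]; ring
  -- Tonelli on the window × ball
  have hmeasW : AEMeasurable (fun w : ℝ × EuclideanSpace ℝ (Fin 3) => ‖ν⁻¹ • u (w.1 / ν) w.2‖ₑ ^ (3 : ℕ))
      ((volume.restrict (Set.Ioo A d)).prod (volume.restrict (ball x₀ r'))) := by
    rw [Measure.prod_restrict, ← Measure.volume_eq_prod]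
    have hg : Continuous (fun w : ℝ × EuclideanSpace ℝ (Fin 3) => (w.1 / ν, w.2)) := by fun_prop
    have hmaps : Set.MapsTo (fun w : ℝ × EuclideanSpace ℝ (Fin 3) => (w.1 / ν, w.2))
        (Set.Ioo A d ×ˢ ball x₀ r') (Set.Ico 0 T ×ˢ univ) := by
      intro w hw
      have hw1 : A < w.1 := hw.1.1
      have hw2 : w.1 < d := hw.1.2
      rw [hddef] at hw2
      refine ⟨⟨div_nonneg (hA0.trans hw1.le) hν.le, ?_⟩, trivial⟩
      rw [div_lt_iff₀ hν]; linarith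
    have hc' : ContinuousOn (fun w : ℝ × EuclideanSpace ℝ (Fin 3) => ν⁻¹ • u (w.1 / ν) w.2)
        (Set.Ioo A d ×ˢ ball x₀ r') :=
      (hcont.comp hg.continuousOn hmaps).const_smul ν⁻¹
    exact (hc'.aestronglyMeasurable (measurableSet_Ioo.prod measurableSet_ball)).enorm.pow_const _
  have hY : ∫⁻ w in parabolicCylinder r' (d, x₀), ‖vNu w.1 w.2‖ₑ ^ (3 : ℕ) =
      ∫⁻ s in Set.Ioo A d, ∫⁻ y in ball x₀ r', ‖ν⁻¹ • u (s / ν) y‖ₑ ^ (3 : ℕ) := by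
    show ∫⁻ w in Set.Ioo (d - r' ^ 2) d ×ˢ ball x₀ r', ‖ν⁻¹ • u (w.1 / ν) w.2‖ₑ ^ (3 : ℕ) = _
    rw [Measure.volume_eq_prod, ← Measure.prod_restrict]
    exact lintegral_prod _ hmeasW
  -- slice bounds: early (cube of the clock) and late (clock × tempered slice energy)
  have hS_early : ∀ s ∈ Set.Ioo A d, ∫⁻ y in ball x₀ r', ‖ν⁻¹ • u (s / ν) y‖ₑ ^ (3 : ℕ) ≤
      ENNReal.ofReal ((κ * (d - s) ^ (-β)) ^ 3) * volume (ball x₀ r') := by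
    intro s hs
    calc ∫⁻ y in ball x₀ r', ‖ν⁻¹ • u (s / ν) y‖ₑ ^ (3 : ℕ)
        ≤ ∫⁻ y in ball x₀ r', ENNReal.ofReal ((κ * (d - s) ^ (-β)) ^ 3) :=
          setLIntegral_mono' measurableSet_ball fun y hy => by
            rw [← ofReal_norm, ← ENNReal.ofReal_pow (norm_nonneg _)]
            exact ENNReal.ofReal_le_ofReal (pow_le_pow_left₀ (norm_nonneg _) (hpt s hs y hy) 3)
      _ = ENNReal.ofReal ((κ * (d - s) ^ (-β)) ^ 3) * volume (ball x₀ r') := setLIntegral_const _ _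
  have hS_late : ∀ s ∈ Set.Ioo A d, ∫⁻ y in ball x₀ r', ‖ν⁻¹ • u (s / ν) y‖ₑ ^ (3 : ℕ) ≤
      ENNReal.ofReal (κ * (d - s) ^ (-β)) *
        ENNReal.ofReal (ν⁻¹ ^ 2 * ((2 * J + 2) * (C * r' ^ (3 - 2 * a)))) := by
    intro s hs
    have hs' : s ∈ Set.Ioo (ν * T - r' ^ 2) (ν * T) := by
      have h1 : A < s := hs.1
      have h2 : s < d := hs.2
      rw [hAdef, hddef] at h1
      rw [hddef] at h2
      exact ⟨h1, h2⟩
    have h2 : ∫⁻ y in ball x₀ r', ‖ν⁻¹ • u (s / ν) y‖ₑ ^ 2 ≤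
        ENNReal.ofReal (ν⁻¹ ^ 2 * ((2 * J + 2) * (C * r' ^ (3 - 2 * a)))) := by
      have hpull : ∫⁻ y in ball x₀ r', ‖ν⁻¹ • u (s / ν) y‖ₑ ^ 2 =
          ENNReal.ofReal (ν⁻¹ ^ 2) * ∫⁻ y in ball x₀ r', ‖u (s / ν) y‖ₑ ^ 2 := by
        rw [← lintegral_const_mul' _ _ ENNReal.ofReal_ne_top]
        refine lintegral_congr fun x => ?_
        rw [enorm_smul, mul_pow, Real.enorm_eq_ofReal (by positivity), ENNReal.ofReal_pow (by positivity)]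
      rw [hpull, ENNReal.ofReal_mul (by positivity)]
      exact mul_le_mul' le_rfl (sliceSq_le_of_temperedAt hν hTm hC hJ htemp ⟨hR0, hRr₀⟩ hs')
    calc ∫⁻ y in ball x₀ r', ‖ν⁻¹ • u (s / ν) y‖ₑ ^ (3 : ℕ)
        = ∫⁻ y in ball x₀ r', ‖ν⁻¹ • u (s / ν) y‖ₑ * ‖ν⁻¹ • u (s / ν) y‖ₑ ^ 2 :=
          lintegral_congr fun y => by ring
      _ ≤ ∫⁻ y in ball x₀ r', ENNReal.ofReal (κ * (d - s) ^ (-β)) * ‖ν⁻¹ • u (s / ν) y‖ₑ ^ 2 :=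
          setLIntegral_mono' measurableSet_ball fun y hy => by
            refine mul_le_mul' ?_ le_rfl
            rw [← ofReal_norm]
            exact ENNReal.ofReal_le_ofReal (hpt s hs y hy)
      _ = ENNReal.ofReal (κ * (d - s) ^ (-β)) * ∫⁻ y in ball x₀ r', ‖ν⁻¹ • u (s / ν) y‖ₑ ^ 2 :=
          lintegral_const_mul' _ _ ENNReal.ofReal_ne_top
      _ ≤ ENNReal.ofReal (κ * (d - s) ^ (-β)) *
            ENNReal.ofReal (ν⁻¹ ^ 2 * ((2 * J + 2) * (C * r' ^ (3 - 2 * a)))) := mul_le_mul' le_rfl h2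
  -- EARLY regime: s ∈ (A, m], time integral of the cubed clock
  have hcongr : Set.EqOn (fun s => (κ * (d - s) ^ (-β)) ^ 3) (fun s => κ ^ 3 * (d - s) ^ (-(3 * β)))
      (Set.Ioc A m) := by
    intro s hs
    have hds : 0 ≤ d - s := by linarith [hs.2]
    show (κ * (d - s) ^ (-β)) ^ 3 = κ ^ 3 * (d - s) ^ (-(3 * β))
    rw [mul_pow, ← Real.rpow_natCast ((d - s) ^ (-β)) 3, ← Real.rpow_mul hds,
      show -β * ((3 : ℕ) : ℝ) = -(3 * β) by push_cast; ring]
  have hIe : IntegrableOn (fun s => (κ * (d - s) ^ (-β)) ^ 3) (Set.Ioc A m) volume := by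
    have hc : ContinuousOn (fun s => (κ * (d - s) ^ (-β)) ^ 3) (Set.Icc A m) := by
      refine (continuousOn_const.mul ((continuousOn_const.sub continuousOn_id).rpow_const ?_)).pow 3
      intro x hx
      left
      show d - x ≠ 0
      exact ne_of_gt (by linarith [hx.2, hmd])
    exact hc.integrableOn_Icc.mono_set Set.Ioc_subset_Icc_self
  have hnnE : 0 ≤ᵐ[volume.restrict (Set.Ioc A m)] fun s => (κ * (d - s) ^ (-β)) ^ 3 :=
    (ae_restrict_iff' measurableSet_Ioc).2 (Eventually.of_forall fun s hs =>
      pow_nonneg (mul_nonneg hκ (Real.rpow_nonneg (by linarith [hs.2]) _)) 3)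
  have hrealE : ∫ s in Set.Ioc A m, (κ * (d - s) ^ (-β)) ^ 3 ≤ κ ^ 3 * (σs ^ (1 - 3 * β) / (3 * β - 1)) := by
    rw [setIntegral_congr_fun measurableSet_Ioc hcongr, integral_const_mul, ← intervalIntegral.integral_of_le hAm]
    have h := early_time_integral h3β hAm hmd
    rw [hdm] at h
    exact mul_le_mul_of_nonneg_left h (pow_nonneg hκ 3)
  have hEarly : ∫⁻ s in Set.Ioc A m, ∫⁻ y in ball x₀ r', ‖ν⁻¹ • u (s / ν) y‖ₑ ^ (3 : ℕ) ≤
      ENNReal.ofReal (κ ^ 3 * (σs ^ (1 - 3 * β) / (3 * β - 1))) * volume (ball x₀ r') := by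
    calc ∫⁻ s in Set.Ioc A m, ∫⁻ y in ball x₀ r', ‖ν⁻¹ • u (s / ν) y‖ₑ ^ (3 : ℕ)
        ≤ ∫⁻ s in Set.Ioc A m, ENNReal.ofReal ((κ * (d - s) ^ (-β)) ^ 3) * volume (ball x₀ r') :=
          setLIntegral_mono' measurableSet_Ioc fun s hs => hS_early s ⟨hs.1, lt_of_le_of_lt hs.2 hmd⟩
      _ = (∫⁻ s in Set.Ioc A m, ENNReal.ofReal ((κ * (d - s) ^ (-β)) ^ 3)) * volume (ball x₀ r') :=
          lintegral_mul_const' _ _ measure_ball_lt_top.ne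
      _ = ENNReal.ofReal (∫ s in Set.Ioc A m, (κ * (d - s) ^ (-β)) ^ 3) * volume (ball x₀ r') := by
          rw [← ofReal_integral_eq_lintegral_ofReal hIe hnnE]
      _ ≤ ENNReal.ofReal (κ ^ 3 * (σs ^ (1 - 3 * β) / (3 * β - 1))) * volume (ball x₀ r') :=
          mul_le_mul' (ENNReal.ofReal_le_ofReal hrealE) le_rfl
  -- LATE regime: s ∈ (m, d), time integral of the clock
  have hIl : IntegrableOn (fun s => κ * (d - s) ^ (-β)) (Set.Ioo m d) volume := by
    have h1 : IntervalIntegrable (fun x : ℝ => x ^ (-β)) volume 0 σs :=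
      intervalIntegral.intervalIntegrable_rpow' (by linarith)
    have h2 := (h1.comp_sub_left d).symm
    rw [sub_zero] at h2
    have h3 : IntegrableOn (fun x => (d - x) ^ (-β)) (Set.Ioo m d) volume := by
      rw [hmdef]
      exact (intervalIntegrable_iff_integrableOn_Ioo_of_le (by linarith)).1 h2
    exact h3.const_mul κ
  have hnnL : 0 ≤ᵐ[volume.restrict (Set.Ioo m d)] fun s => κ * (d - s) ^ (-β) :=
    (ae_restrict_iff' measurableSet_Ioo).2 (Eventually.of_forall fun s hs =>
      mul_nonneg hκ (Real.rpow_nonneg (by linarith [hs.2]) _))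
  have hrealL : ∫ s in Set.Ioo m d, κ * (d - s) ^ (-β) = κ * (σs ^ (1 - β) / (1 - β)) := by
    rw [integral_const_mul, ← integral_Ioc_eq_integral_Ioo, ← intervalIntegral.integral_of_le hmd.le, hmdef,
      late_time_integral hβ1 hσs.le]
  have hLate : ∫⁻ s in Set.Ioo m d, ∫⁻ y in ball x₀ r', ‖ν⁻¹ • u (s / ν) y‖ₑ ^ (3 : ℕ) ≤
      ENNReal.ofReal (κ * (σs ^ (1 - β) / (1 - β))) *
        ENNReal.ofReal (ν⁻¹ ^ 2 * ((2 * J + 2) * (C * r' ^ (3 - 2 * a)))) := by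
    calc ∫⁻ s in Set.Ioo m d, ∫⁻ y in ball x₀ r', ‖ν⁻¹ • u (s / ν) y‖ₑ ^ (3 : ℕ)
        ≤ ∫⁻ s in Set.Ioo m d, ENNReal.ofReal (κ * (d - s) ^ (-β)) *
            ENNReal.ofReal (ν⁻¹ ^ 2 * ((2 * J + 2) * (C * r' ^ (3 - 2 * a)))) :=
          setLIntegral_mono' measurableSet_Ioo fun s hs => hS_late s ⟨lt_of_le_of_lt hAm hs.1, hs.2⟩
      _ = (∫⁻ s in Set.Ioo m d, ENNReal.ofReal (κ * (d - s) ^ (-β))) *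
            ENNReal.ofReal (ν⁻¹ ^ 2 * ((2 * J + 2) * (C * r' ^ (3 - 2 * a)))) :=
          lintegral_mul_const' _ _ ENNReal.ofReal_ne_top
      _ = ENNReal.ofReal (κ * (σs ^ (1 - β) / (1 - β))) *
            ENNReal.ofReal (ν⁻¹ ^ 2 * ((2 * J + 2) * (C * r' ^ (3 - 2 * a)))) := by
          rw [← ofReal_integral_eq_lintegral_ofReal hIl hnnL, hrealL]
  -- exponent bookkeeping: both regimes give r'^{4−2a}
  have hσ1 : σs ^ (1 - 3 * β) = r' ^ (1 - 2 * a) := by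
    rw [hσsdef, ← Real.rpow_mul hR0.le]
    congr 1
    rw [mul_sub, mul_one, show (1 + a) * (3 * β) = 3 * ((1 + a) * β) by ring, hβa]; ring
  have hσ2 : σs ^ (1 - β) = r' ^ (1 : ℝ) := by
    rw [hσsdef, ← Real.rpow_mul hR0.le]
    congr 1
    rw [mul_sub, mul_one, hβa]; ring
  have e1 : r' ^ (1 - 2 * a) * r' ^ (3 : ℕ) = r' ^ (4 - 2 * a) := by
    rw [← Real.rpow_natCast r' 3, ← Real.rpow_add hR0]
    congr 1; push_cast; ring
  have e2 : r' ^ (1 : ℝ) * r' ^ (3 - 2 * a) = r' ^ (4 - 2 * a) := by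
    rw [← Real.rpow_add hR0]
    congr 1; ring
  have hvol : volume (ball x₀ r') = ENNReal.ofReal (r' ^ 3) * V := by
    rw [hVdef, Measure.addHaar_ball_of_pos volume x₀ hR0, finrank_euclideanSpace_fin]
  have hsplit : Set.Ioo A d = Set.Ioc A m ∪ Set.Ioo m d := (Set.Ioc_union_Ioo_eq_Ioo hAm hmd).symm
  have hP1 : 0 ≤ κ ^ 3 * (r' ^ (1 - 2 * a) / (3 * β - 1)) :=
    mul_nonneg (pow_nonneg hκ 3) (div_nonneg (Real.rpow_nonneg hR0.le _) (by linarith))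
  have hP2 : 0 ≤ κ * (r' ^ (1 : ℝ) / (1 - β)) :=
    mul_nonneg hκ (div_nonneg (Real.rpow_nonneg hR0.le _) (by linarith))
  have hQ : ∫⁻ w in parabolicCylinder r' (d, x₀), ‖vNu w.1 w.2‖ₑ ^ (3 : ℕ) ≤
      ENNReal.ofReal (r' ^ (4 - 2 * a)) * Mtot := by
    rw [hY, hsplit]
    refine (lintegral_union_le _ _ _).trans ((add_le_add hEarly hLate).trans (le_of_eq ?_))
    rw [hvol, hσ1, hσ2, hMdef, mul_add]
    congr 1
    · rw [← mul_assoc, ← ENNReal.ofReal_mul hP1, mul_comm V, ← mul_assoc,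
        ← ENNReal.ofReal_mul (Real.rpow_nonneg hR0.le _)]
      congr 2
      rw [← e1]; ring
    · rw [← ENNReal.ofReal_mul hP2, ← ENNReal.ofReal_mul (Real.rpow_nonneg hR0.le _)]
      congr 1
      rw [← e2]; ring
  -- the cubic gauge
  show ENNReal.ofReal (r' ^ (2 * (a - 1))) * cknC r' (d, x₀) (vNu) ≤ Mtot
  unfold cknC
  calc ENNReal.ofReal (r' ^ (2 * (a - 1))) *
        ((ENNReal.ofReal r' ^ 2)⁻¹ * ∫⁻ w in parabolicCylinder r' (d, x₀), ‖vNu w.1 w.2‖ₑ ^ (3 : ℕ))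
      ≤ ENNReal.ofReal (r' ^ (2 * (a - 1))) *
          ((ENNReal.ofReal r' ^ 2)⁻¹ * (ENNReal.ofReal (r' ^ (4 - 2 * a)) * Mtot)) := by
        gcongr
    _ = Mtot := by
        rw [← ENNReal.ofReal_pow hR0.le, ← ENNReal.ofReal_inv_of_pos (pow_pos hR0 2), ← mul_assoc, ← mul_assoc,
          ← ENNReal.ofReal_mul (Real.rpow_nonneg hR0.le _), ← ENNReal.ofReal_mul (by positivity)]
        have h1 : r' ^ (2 * (a - 1)) * (r' ^ 2)⁻¹ * r' ^ (4 - 2 * a) = 1 := by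
          rw [← Real.rpow_natCast r' 2, ← Real.rpow_neg hR0.le, ← Real.rpow_add hR0, ← Real.rpow_add hR0,
            show 2 * (a - 1) + -((2 : ℕ) : ℝ) + (4 - 2 * a) = 0 by push_cast; ring, Real.rpow_zero]
        rw [h1, ENNReal.ofReal_one, one_mul]

/-- **K5 corollary · RT ⟹ CC.** The velocity-clock attack signature implies the cubic-gauge piece outright (the
tempered hypothesis is part of CC's frame); so RT is a genuine SUFFICIENT attack line for CC, bookable as a line/stub. -/
theorem conicalSkirtCubicGauge_of_velocityClockedSkirt
    (hRT : ∀ (ν T : ℝ), 0 < ν → 0 < T → ∀ (u : ℝ → EuclideanSpace ℝ (Fin 3) → EuclideanSpace ℝ (Fin 3)) (p : ℝ → EuclideanSpace ℝ (Fin 3) → ℝ), Literature.Analysis.FluidPDE.IsMaximalSmoothSolution ν 0 u p T → Literature.Analysis.FluidPDE.IsLerayHopfOn T ν 0 (u 0) u → Literature.Analysis.FluidPDE.HasRapidSpatialDecay (u 0) → Filter.Tendsto (fun t => MeasureTheory.eLpNorm (u t - u T) 2 MeasureTheory.volume) (nhdsWithin T (Set.Iio T)) (nhds 0) → ∀ (x₀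 : EuclideanSpace ℝ (Fin 3)) (r : ℕ → ℝ) (a r₀ C J c η : ℝ), ((∀ k, 0 < r k) ∧ Filter.Tendsto r Filter.atTop (nhds 0) ∧ Filter.Tendsto (fun k => (r k)⁻¹ * ∫ x in Metric.ball x₀ (r k), ‖u T x‖ ^ 2) Filter.atTop Filter.atTop) → (∃ c : ℝ, 0 < c ∧ ∀ k, ∃ t ∈ Set.Ioo (T - r k ^ 2) T, c * (∫ x in Metric.ball x₀ (r k), ‖u T x‖ ^ 2) < ∫ x in Metric.ball x₀ (r k), ‖u t x - u T x‖ ^ 2) → 1 < a → a ≤ 3 / 2 → 0 < r₀ → 0 ≤ C → 0 ≤ J → 0 < c → 0 < η → (∀ ρ ∈ Set.Ioc 0 r₀, (∫⁻ x in Metric.ball x₀ ρ, ‖u T x‖ₑ ^ 2 ≤ ENNReal.ofReal (C * ρ ^ (3 - 2 * a))) ∧ ∀ s ∈ Set.Ioo (T - ρ ^ 2 / ν) T, ∫⁻ x in Metric.ball x₀ ρ, ‖u s x - u T x‖ₑ ^ 2 ≤ ENNReal.ofReal J * ∫⁻ x in Metric.ball x₀ ρ, ‖u T x‖ₑ ^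 2) → (∀ k : ℕ, ENNReal.ofReal (c * r k ^ (3 - 2 * a)) ≤ ∫⁻ x in Metric.ball x₀ (r k), ‖u T x‖ₑ ^ 2 ∧ ∀ s ∈ Set.Ioo (T - r k ^ (1 + a) / ν) T, ENNReal.ofReal η * ∫⁻ x in Metric.ball x₀ (r k), ‖u T x‖ₑ ^ 2 ≤ ∫⁻ x in Metric.ball x₀ (r k), ‖u s x‖ₑ ^ 2) → ∃ (K r₂ : ℝ), 0 < r₂ ∧ ∀ t ∈ Set.Ioo (T - r₂ ^ 2) T, ∀ x ∈ Metric.ball x₀ r₂, ‖u t x‖ ≤ K * (T - t) ^ (-(a / (1 + a)))) :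
    ∀ (ν T : ℝ), 0 < ν → 0 < T → ∀ (u : ℝ → EuclideanSpace ℝ (Fin 3) → EuclideanSpace ℝ (Fin 3)) (p : ℝ → EuclideanSpace ℝ (Fin 3) → ℝ), Literature.Analysis.FluidPDE.IsMaximalSmoothSolution ν 0 u p T → Literature.Analysis.FluidPDE.IsLerayHopfOn T ν 0 (u 0) u → Literature.Analysis.FluidPDE.HasRapidSpatialDecay (u 0) → Filter.Tendsto (fun t => MeasureTheory.eLpNorm (u t - u T) 2 MeasureTheory.volume) (nhdsWithin T (Set.Iio T)) (nhds 0) → ∀ (x₀ : EuclideanSpace ℝ (Fin 3)) (r : ℕ → ℝ) (a r₀ C J c η : ℝ), ((∀ k, 0 < r k) ∧ Filter.Tendsto r Filter.atTop (nhds 0) ∧ Filter.Tendsto (fun k => (r k)⁻¹ * ∫ x in Metric.ball x₀ (r k), ‖u T x‖ ^ 2) Filter.atTop Filter.atTop) → (∃ c : ℝ, 0 < c ∧ ∀ k, ∃ t ∈ Set.Ioo (T - r k ^ 2) T, c * (∫ x in Metric.ball x₀ (r k), ‖u T x‖ ^ 2) < ∫ x in Metric.ball x₀ (r k), ‖u t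 x - u T x‖ ^ 2) → 1 < a → a ≤ 3 / 2 → 0 < r₀ → 0 ≤ C → 0 ≤ J → 0 < c → 0 < η → (∀ ρ ∈ Set.Ioc 0 r₀, (∫⁻ x in Metric.ball x₀ ρ, ‖u T x‖ₑ ^ 2 ≤ ENNReal.ofReal (C * ρ ^ (3 - 2 * a))) ∧ ∀ s ∈ Set.Ioo (T - ρ ^ 2 / ν) T, ∫⁻ x in Metric.ball x₀ ρ, ‖u s x - u T x‖ₑ ^ 2 ≤ ENNReal.ofReal J * ∫⁻ x in Metric.ball x₀ ρ, ‖u T x‖ₑ ^ 2) → (∀ k : ℕ, ENNReal.ofReal (c * r k ^ (3 - 2 * a)) ≤ ∫⁻ x in Metric.ball x₀ (r k), ‖u T x‖ₑ ^ 2 ∧ ∀ s ∈ Set.Ioo (T - r k ^ (1 + a) / ν) T, ENNReal.ofReal η * ∫⁻ x in Metric.ball x₀ (r k), ‖u T x‖ₑ ^ 2 ≤ ∫⁻ x in Metric.ball x₀ (r k), ‖u s x‖ₑ ^ 2) → ∃ (r₁ : ℝ) (M : NNReal), 0 < r₁ ∧ ∀ r' ∈ Set.Ioc 0 r₁, ENNReal.ofReal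 (r' ^ (2 * (a - 1))) * Literature.Analysis.FluidPDE.cknC r' (ν * T, x₀) (fun s y => ν⁻¹ • u (s / ν) y) ≤ (M : ENNReal) := by
  intro ν T hν hT u p hmax hLH hdec htend x₀ r a r₀ C J c η hs hj ha1 ha2 hr₀ hC hJ hc hη htemp hfloor
  obtain ⟨K, r₂, hr₂, hclock⟩ :=
    hRT ν T hν hT u p hmax hLH hdec htend x₀ r a r₀ C J c η hs hj ha1 ha2 hr₀ hC hJ hc hη htemp hfloor
  have hclock' : ∀ t ∈ Set.Ioo (T - r₂ ^ 2) T, ∀ x ∈ ball x₀ r₂,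
      ‖u t x‖ ≤ max K 0 * (T - t) ^ (-(a / (1 + a))) := fun t ht x hx =>
    (hclock t ht x hx).trans
      (mul_le_mul_of_nonneg_right (le_max_left _ _) (Real.rpow_nonneg (by linarith [ht.2]) _))
  exact cubicGauge_of_velocityClock hν hT hmax hLH ha1 hr₀ hC hJ (le_max_right _ _) hr₂ htemp hclock'

end Summit.NavierStokesRegularity.NavierStokesRegularity.Theorems.RootDecompStaticSkirtVelocityClock

end
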